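import Literature.Analysis.FluidPDE.AxisymNoSwirlImpulseConservation
import Literature.Analysis.FluidPDE.HydrodynamicImpulse
import HarnessLib

/-!
# Hydrodynamic impulse, IV: the AXIAL IMPULSE BALANCE from the ENERGY alone —
# `∫ (x × ω)₃(t) − ∫ (x × ω)₃(s) = 2 ∫ₛᵗ ∫ f₃` for every finite-energy classical forced flow on `ℝ³`
# (Saffman (3.2.9), no decay hypothesis on the vorticity)

Saffman, *Vortex Dynamics* (CUP 1992), §3.2 eq. (9): `dI/dt = ∫ F dV`, `I = ½ ∫ x × ω dV`. The companion file
`HydrodynamicImpulseBalance.lean` proves the vector law under a first-moment hypothesis on the vorticity (Fubini on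
`x × ∂ₜω`). Here the AXIAL component is obtained with NO hypothesis on the vorticity inside the time interval —
only the classical equations, a uniform ENERGY level `∫ ‖u(τ)‖² ≤ E` and an integrable majorant of the force
slices — by the route of the tree's `GallaySverak2015.ImpulseConservation_holds`
(`AxisymNoSwirlImpulseConservation.lean`, the unforced swirl-free case), which this file generalises to forced
flows: with the cut-off `χ_R = cutoff R`, `Jx = (−x₁, x₀, 0)` and the compactly supported divergence-free test
field `ψ_R = curl (χ_R J)`,

* `∫ χ_R (x × ω)₃ dx = ∫ ⟪curl u, χ_R J⟫ = ∫ ⟪u, ψ_R⟫` (integration by parts for the curl);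
* the momentum equation tested against `ψ_R` (`IsClassicalNSSolutionOn.integral_inner_sub_eq_pressure`; the
  pressure pairs with `div ψ_R = 0`) gives
  `∫⟪u(t), ψ_R⟫ − ∫⟪u(s), ψ_R⟫ = ∫ₛᵗ ∫ (⟪u,(u·∇)ψ_R⟫ + ν⟪u,Δψ_R⟫) + ∫ₛᵗ ∫ ⟪f, ψ_R⟫`, where the first
  term is `O((t−s)/√R)` by the slice estimate of that file (only the energy enters: `‖Dψ_R‖ ≤ B₁/R`,
  `‖Δψ_R‖ ≤ B₂/R²`);
* NEW: `ψ_R(x) = 2e₃` as soon as `R > ‖x‖` (`χ_R ≡ 1` on the ball, `curl J = (0,0,2)`) and `‖ψ_R‖ ≤ B₀` uniformly,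
  so `∫ₛᵗ ∫ ⟪f, ψ_R⟫ → 2 ∫ₛᵗ ∫ f₃` by dominated convergence (`tendsto_intervalIntegral_integral_inner_force`).

Results (`(x × ω)₃ = swirl ω = x₀ω₁ − x₁ω₀` in the tree's notation):

* `IsClassicalNSSolutionOn.tendsto_integral_cutoff_swirl_vorticity_sub` — the truncated axial impulses satisfy
  `∫ χ_n swirl ω(t) − ∫ χ_n swirl ω(s) → 2 ∫ₛᵗ ∫ f₃` (`n → ∞`), for EVERY classical finite-energy forced flow;
* `IsClassicalNSSolutionOn.integral_swirl_vorticity_sub_eq_of_energy` — if the axial impulse densities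
  `swirl ω(t)`, `swirl ω(s)` are integrable, `∫ swirl ω(t) − ∫ swirl ω(s) = 2 ∫ₛᵗ ∫ f₃`;
* `IsClassicalNSSolutionOn.integrable_swirl_vorticity_of_nonneg` / `…integral_swirl_vorticity_eq_of_nonneg` —
  Fatou form: if `swirl ω(s) ∈ L¹` and `swirl ω(t) ≥ 0` (a single-signed slice, e.g. a vortex ring), then
  `swirl ω(t) ∈ L¹` automatically and the law holds.

Consequence (cell `ns-blowup`, item 19249's negative lane, no decay hypothesis left): a registered stage whose
readout slice is a single-signed swirl-free field was pushed with `∫₀^{τ}∫ f₃ = ½ ∫ r²(ω_θ/r) > 0`.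

References: P. G. Saffman, *Vortex Dynamics* (1992) §3.2 (3.2.8), (3.2.9) [cite: Saffman1992, §3.2 (3.2.8)–(3.2.9)];
Th. Gallay, V. Šverák, Confluentes Math. 7 (2015), Lemma 6.4 (arXiv p. 19) [cite: GallaySverak2016, Lemma 6.4];
J. Leray, Acta Math. 63 (1934) §III (17) [cite: Leray1934, §III (17)].
-/

noncomputable section

open MeasureTheory Set Function Filter Topology InnerProductSpace Metric
open scoped RealInnerProductSpace ENNReal NNReal Laplacian ContDiff Interval

namespace Literature.Analysis.FluidPDE

/-! ### §1 The impulse test fields `ψ_R = curl (χ_R J)` (after `AxisymNoSwirlImpulseConservation.lean`) -/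

section TestField

/-- The vector potential `χ_R J` is smooth. [folklore] -/
private theorem contDiff_cutoff_smul_rotGen' {n : ℕ∞} (R : ℝ) :
    ContDiff ℝ n (fun x : EuclideanSpace ℝ (Fin 3) => cutoff R x • rotGen x) :=
  (contDiff_cutoff R).smul rotGenL.contDiff

/-- The vector potential `χ_R J` has compact support (`R > 0`). [folklore] -/
private theorem hasCompactSupport_cutoff_smul_rotGen' {R : ℝ} (hR : 0 < R) :
    HasCompactSupport (fun x : EuclideanSpace ℝ (Fin 3) => cutoff R x • rotGen x) :=
  (hasCompactSupport_cutoff hR).smul_right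

/-- The vector potential `χ_R J` is supported in the closed ball of radius `2R`. [folklore] -/
private theorem tsupport_cutoff_smul_rotGen_subset' {R : ℝ} (hR : 0 < R) :
    tsupport (fun x : EuclideanSpace ℝ (Fin 3) => cutoff R x • rotGen x) ⊆ closedBall 0 (2 * R) :=
  (tsupport_smul_subset_left _ _).trans (tsupport_cutoff_subset hR)

/-- Scaling of the potential: `χ_R(x) Jx = R · (χ_1 J)(x / R)`. [folklore] -/
private theorem cutoff_smul_rotGen_eq_scale' {R : ℝ} (hR : 0 < R) :
    (fun x : EuclideanSpace ℝ (Fin 3) => cutoff R x • rotGen x) =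
      fun x => R • (fun y : EuclideanSpace ℝ (Fin 3) => cutoff 1 y • rotGen y) (R⁻¹ • x) := by
  funext x
  have h1 : cutoff 1 (R⁻¹ • x) = cutoff R x := by simp [cutoff_apply]
  simp only [h1, rotGen_smul, smul_smul]
  congr 1
  field_simp

/-- Scaling of the Jacobian: `D(χ_R J)(x) = D(χ_1 J)(x / R)`. [folklore] -/
private theorem fderiv_cutoff_smul_rotGen_eq' {R : ℝ} (hR : 0 < R) (x : EuclideanSpace ℝ (Fin 3)) :
    fderiv ℝ (fun x : EuclideanSpace ℝ (Fin 3) => cutoff R x • rotGen x) x =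
      fderiv ℝ (fun y : EuclideanSpace ℝ (Fin 3) => cutoff 1 y • rotGen y) (R⁻¹ • x) := by
  rw [cutoff_smul_rotGen_eq_scale' hR]
  have hd : DifferentiableAt ℝ
      (fun x => (fun y : EuclideanSpace ℝ (Fin 3) => cutoff 1 y • rotGen y) (R⁻¹ • x)) x :=
    (((contDiff_cutoff_smul_rotGen' (n := 1) 1).differentiable one_ne_zero).comp
      (differentiable_id.const_smul R⁻¹)).differentiableAt
  rw [fderiv_fun_const_smul hd,
    fderiv_comp_smul (f := fun y : EuclideanSpace ℝ (Fin 3) => cutoff 1 y • rotGen y) R⁻¹, smul_smul,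
    mul_inv_cancel₀ hR.ne', one_smul]

/-- **Scaling of the test field**: `curl (χ_R J)(x) = curl (χ_1 J)(x / R)`. [folklore] -/
private theorem curl_cutoff_smul_rotGen_eq' {R : ℝ} (hR : 0 < R) (x : EuclideanSpace ℝ (Fin 3)) :
    curl (fun x : EuclideanSpace ℝ (Fin 3) => cutoff R x • rotGen x) x =
      curl (fun y : EuclideanSpace ℝ (Fin 3) => cutoff 1 y • rotGen y) (R⁻¹ • x) := by
  rw [curl_eq_curlCLM, curl_eq_curlCLM, fderiv_cutoff_smul_rotGen_eq' hR]

/-- The test field `curl (χ_R J)` is smooth. [folklore] -/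
private theorem contDiff_curl_cutoff_smul_rotGen' (n : ℕ) (R : ℝ) :
    ContDiff ℝ n (curl fun x : EuclideanSpace ℝ (Fin 3) => cutoff R x • rotGen x) :=
  contDiff_curl (n := n) (by exact_mod_cast contDiff_cutoff_smul_rotGen' (n := (n + 1 : ℕ)) R)

/-- The test field `curl (χ_R J)` has compact support (`R > 0`). [folklore] -/
private theorem hasCompactSupport_curl_cutoff_smul_rotGen' {R : ℝ} (hR : 0 < R) :
    HasCompactSupport (curl fun x : EuclideanSpace ℝ (Fin 3) => cutoff R x • rotGen x) :=
  hasCompactSupport_curl (hasCompactSupport_cutoff_smul_rotGen' hR)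

/-- The test field `curl (χ_R J)` is supported in the closed ball of radius `2R`. [folklore] -/
private theorem tsupport_curl_cutoff_smul_rotGen_subset' {R : ℝ} (hR : 0 < R) :
    tsupport (curl fun x : EuclideanSpace ℝ (Fin 3) => cutoff R x • rotGen x) ⊆
      closedBall 0 (2 * R) := by
  refine (closure_minimal (fun x hx => ?_) (isClosed_tsupport _)).trans
    (tsupport_cutoff_smul_rotGen_subset' hR)
  by_contra hx'
  exact hx (curl_eq_zero_of_notMem_tsupport hx')

/-- The test field `curl (χ_R J)` is divergence free. [folklore] -/
private theorem divergence_curl_cutoff_smul_rotGen' (R : ℝ) (x : EuclideanSpace ℝ (Fin 3)) :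
    VectorCalculus.divergence (curl fun x : EuclideanSpace ℝ (Fin 3) => cutoff R x • rotGen x) x = 0 :=
  divergence_curl_eq_zero_holds _ (contDiff_cutoff_smul_rotGen' (n := 2) R) x

/-- **Uniform bounds for the scaled test fields**: `‖curl (χ_R J)(x)‖ ≤ B₀`, `‖D(curl (χ_R J))(x)‖ ≤ B₁ / R` and
`‖Δ(curl (χ_R J))(x)‖ ≤ B₂ / R²` for all `R > 0` and all `x` (scaling from the fixed profile
`curl (χ_1 J) ∈ C_c^∞`). [folklore] -/
private theorem exists_bounds_curl_cutoff_smul_rotGen' :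
    ∃ B₀ B₁ B₂ : ℝ, 0 ≤ B₀ ∧ 0 ≤ B₁ ∧ 0 ≤ B₂ ∧ ∀ R : ℝ, 0 < R → ∀ x : EuclideanSpace ℝ (Fin 3),
      ‖curl (fun x : EuclideanSpace ℝ (Fin 3) => cutoff R x • rotGen x) x‖ ≤ B₀ ∧
      ‖fderiv ℝ (curl fun x : EuclideanSpace ℝ (Fin 3) => cutoff R x • rotGen x) x‖ ≤ B₁ / R ∧
        ‖Δ (curl fun x : EuclideanSpace ℝ (Fin 3) => cutoff R x • rotGen x) x‖ ≤ B₂ / R ^ 2 := by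
  set ψ₁ : EuclideanSpace ℝ (Fin 3) → EuclideanSpace ℝ (Fin 3) :=
    curl fun y : EuclideanSpace ℝ (Fin 3) => cutoff 1 y • rotGen y with hψ₁
  have hψ2 : ContDiff ℝ 2 ψ₁ := contDiff_curl_cutoff_smul_rotGen' 2 1
  have hψ1 : ContDiff ℝ 1 ψ₁ := hψ2.of_le one_le_two
  have hψc : HasCompactSupport ψ₁ := hasCompactSupport_curl_cutoff_smul_rotGen' one_pos
  obtain ⟨B₀, hB₀⟩ := hψ1.continuous.bounded_above_of_compact_support hψc
  obtain ⟨B₁, hB₁⟩ := (hψ1.continuous_fderiv one_ne_zero).bounded_above_of_compact_support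
    (hψc.fderiv (𝕜 := ℝ))
  have hΔc : HasCompactSupport (Δ ψ₁) :=
    HasCompactSupport.intro hψc fun x hx => laplacian_eq_zero_of_notMem_tsupport hx
  obtain ⟨B₂, hB₂⟩ := (continuous_laplacian hψ2).bounded_above_of_compact_support hΔc
  have hB₀0 : 0 ≤ B₀ := (norm_nonneg _).trans (hB₀ 0)
  have hB₁0 : 0 ≤ B₁ := (norm_nonneg _).trans (hB₁ 0)
  have hB₂0 : 0 ≤ B₂ := (norm_nonneg _).trans (hB₂ 0)
  refine ⟨B₀, B₁, B₂, hB₀0, hB₁0, hB₂0, fun R hR x => ?_⟩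
  have hfun : (curl fun x : EuclideanSpace ℝ (Fin 3) => cutoff R x • rotGen x) =
      fun x => ψ₁ (R⁻¹ • x) := funext fun x => curl_cutoff_smul_rotGen_eq' hR x
  have hRinv : 0 ≤ R⁻¹ := inv_nonneg.2 hR.le
  rw [hfun]
  refine ⟨hB₀ _, ?_, ?_⟩
  · rw [fderiv_comp_smul R⁻¹, norm_smul, Real.norm_of_nonneg hRinv, div_eq_inv_mul]
    exact mul_le_mul_of_nonneg_left (hB₁ _) hRinv
  · rw [laplacian_comp_smul hψ2 R⁻¹ x, norm_smul, norm_pow, Real.norm_of_nonneg hRinv, inv_pow,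
      div_eq_inv_mul]
    exact mul_le_mul_of_nonneg_left (hB₂ _) (by positivity)

/-- `curl J = (0, 0, 2)`: the curl of the rotation generator `Jx = (−x₁, x₀, 0)` is the constant vector `2e₃`.
[folklore] -/
private theorem curl_rotGen (x : EuclideanSpace ℝ (Fin 3)) :
    curl rotGen x = EuclideanSpace.single 2 (2 : ℝ) := by
  ext i
  fin_cases i <;> simp [curl, fderiv_rotGen, rotGen]
  norm_num

/-- **The test field is eventually the constant `2e₃`**: for `‖x‖ < R`, `curl (χ_R J)(x) = (0, 0, 2)` (the
cut-off is `≡ 1` on the ball of radius `R`). [folklore] -/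
private theorem curl_cutoff_smul_rotGen_eq_single {R : ℝ} {x : EuclideanSpace ℝ (Fin 3)} (hx : ‖x‖ < R) :
    curl (fun y : EuclideanSpace ℝ (Fin 3) => cutoff R y • rotGen y) x = EuclideanSpace.single 2 (2 : ℝ) := by
  have hR : 0 < R := (norm_nonneg x).trans_lt hx
  have hev : (fun y : EuclideanSpace ℝ (Fin 3) => cutoff R y • rotGen y) =ᶠ[𝓝 x] rotGen := by
    have ho : IsOpen {y : EuclideanSpace ℝ (Fin 3) | ‖y‖ < R} := isOpen_lt continuous_norm continuous_const
    filter_upwards [ho.mem_nhds hx] with y hy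
    rw [cutoff_eq_one hR (le_of_lt hy), one_smul]
  rw [curl_eq_curlCLM, hev.fderiv_eq, ← curl_eq_curlCLM, curl_rotGen]

/-- **Pointwise limit of the test fields**: `curl (χ_{n+1} J)(x) → 2e₃` as `n → ∞` (eventually constant).
[folklore] -/
private theorem tendsto_curl_cutoff_smul_rotGen (x : EuclideanSpace ℝ (Fin 3)) :
    Tendsto (fun n : ℕ => curl (fun y : EuclideanSpace ℝ (Fin 3) => cutoff ((n : ℝ) + 1) y • rotGen y) x)
      atTop (𝓝 (EuclideanSpace.single 2 (2 : ℝ))) := by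
  refine tendsto_const_nhds.congr' ?_
  refine (eventually_gt_atTop ⌈‖x‖⌉₊).mono fun n hn => ?_
  have hxn : ‖x‖ < (n : ℝ) + 1 := by
    have h1 := Nat.le_ceil ‖x‖
    have h2 : (⌈‖x‖⌉₊ : ℝ) < n := by exact_mod_cast hn
    linarith
  exact (curl_cutoff_smul_rotGen_eq_single hxn).symm

end TestField

/-! ### §2 The truncated axial impulse as a velocity pairing -/

section Pairing

/-- **Moving the curl onto the weight**: `∫ χ_R swirl (curl v) = ∫ ⟪v, curl (χ_R J)⟫` for `v ∈ C¹`
(`swirl w x = ⟪w x, Jx⟫`; integration by parts for the curl, `integral_inner_curl_eq_integral_inner_curl`).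
[folklore] -/
private theorem integral_cutoff_mul_swirl_curl_eq_inner
    {v : EuclideanSpace ℝ (Fin 3) → EuclideanSpace ℝ (Fin 3)} (hv : ContDiff ℝ 1 v)
    {R : ℝ} (hR : 0 < R) :
    ∫ x, cutoff R x * swirl (curl v) x =
      ∫ x, ⟪v x, curl (fun y : EuclideanSpace ℝ (Fin 3) => cutoff R y • rotGen y) x⟫ := by
  rw [← integral_inner_curl_eq_integral_inner_curl hv (contDiff_cutoff_smul_rotGen' (n := 1) R)
    (hasCompactSupport_cutoff_smul_rotGen' hR)]
  refine integral_congr_ae (Eventually.of_forall fun x => ?_)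
  simp only [real_inner_smul_right, swirl_eq_inner_rotGen, real_inner_comm]

end Pairing

/-! ### §3 The transport and viscous pairings against `curl (χ_R J)` are `O(R^{-1/2})` (energy only) -/

section SliceBound

/-- **The slice estimate** (verbatim from `AxisymNoSwirlImpulseConservation.lean`): for every `ν` and energy level
`E` there is `K` such that for all `R ≥ 1` and every continuous `v` with `∫ ‖v‖² ≤ E`,
`|∫ (⟪v, (v·∇)ψ_R⟫ + ν ⟪v, Δψ_R⟫)| ≤ K / √R`, `ψ_R = curl (χ_R J)`. [folklore] -/
private theorem exists_pairing_bound' (ν E : ℝ) :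
    ∃ K : ℝ, ∀ R : ℝ, 1 ≤ R →
      ∀ v : EuclideanSpace ℝ (Fin 3) → EuclideanSpace ℝ (Fin 3), Continuous v →
        Integrable (fun x => ‖v x‖ ^ 2) → ∫ x, ‖v x‖ ^ 2 ≤ E →
        |∫ x, (⟪v x, convect v (curl fun y : EuclideanSpace ℝ (Fin 3) => cutoff R y • rotGen y) x⟫ +
            ν * ⟪v x, Δ (curl fun y : EuclideanSpace ℝ (Fin 3) => cutoff R y • rotGen y) x⟫)| ≤
          K / Real.sqrt R := by
  obtain ⟨B₀, B₁, B₂, -, hB₁, hB₂, hB⟩ := exists_bounds_curl_cutoff_smul_rotGen'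
  set c₁ : ℝ := (volume (ball (0 : EuclideanSpace ℝ (Fin 3)) 1)).toReal with hc₁
  have hc₁0 : 0 ≤ c₁ := ENNReal.toReal_nonneg
  refine ⟨B₁ * max E 0 + |ν| * B₂ * (8 * c₁ + max E 0) / 2, fun R hR v hvc hv2 hvE => ?_⟩
  have hR0 : 0 < R := one_pos.trans_le hR
  have hE0 : 0 ≤ E := (integral_nonneg fun x => sq_nonneg _).trans hvE
  rw [max_eq_left hE0]
  set ψ : EuclideanSpace ℝ (Fin 3) → EuclideanSpace ℝ (Fin 3) :=
    curl fun y : EuclideanSpace ℝ (Fin 3) => cutoff R y • rotGen y with hψ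
  set S : Set (EuclideanSpace ℝ (Fin 3)) := closedBall 0 (2 * R) with hS
  set s : ℝ := Real.sqrt R with hs
  have hs0 : 0 < s := Real.sqrt_pos.2 hR0
  have hss : s * s = R := Real.mul_self_sqrt hR0.le
  have hs1 : 1 ≤ s := by rw [hs, ← Real.sqrt_one]; exact Real.sqrt_le_sqrt hR
  set lam : ℝ := (R * s)⁻¹ with hlam
  have hlam0 : 0 < lam := inv_pos.2 (mul_pos hR0 hs0)
  set g : EuclideanSpace ℝ (Fin 3) → ℝ := fun x =>
    B₁ / R * ‖v x‖ ^ 2 +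
      |ν| * (B₂ / R ^ 2) * ((lam * S.indicator (fun _ => (1 : ℝ)) x + lam⁻¹ * ‖v x‖ ^ 2) / 2)
    with hg
  have hνB : 0 ≤ |ν| * (B₂ / R ^ 2) := by positivity
  have hbound : ∀ x, ‖⟪v x, convect v ψ x⟫ + ν * ⟪v x, Δ ψ x⟫‖ ≤ g x := by
    intro x
    obtain ⟨-, hD, hL⟩ := hB R hR0 x
    have h1 : |⟪v x, convect v ψ x⟫| ≤ B₁ / R * ‖v x‖ ^ 2 := by
      calc |⟪v x, convect v ψ x⟫| ≤ ‖v x‖ * ‖convect v ψ x‖ := abs_real_inner_le_norm _ _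
        _ ≤ ‖v x‖ * (‖fderiv ℝ ψ x‖ * ‖v x‖) :=
            mul_le_mul_of_nonneg_left (ContinuousLinearMap.le_opNorm _ _) (norm_nonneg _)
        _ ≤ ‖v x‖ * (B₁ / R * ‖v x‖) := by gcongr
        _ = B₁ / R * ‖v x‖ ^ 2 := by ring
    have h2 : |ν * ⟪v x, Δ ψ x⟫| ≤
        |ν| * (B₂ / R ^ 2) * (‖v x‖ * S.indicator (fun _ => (1 : ℝ)) x) := by
      rw [abs_mul]
      by_cases hx : x ∈ S
      · rw [indicator_of_mem hx, mul_one]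
        calc |ν| * |⟪v x, Δ ψ x⟫| ≤ |ν| * (‖v x‖ * ‖Δ ψ x‖) :=
              mul_le_mul_of_nonneg_left (abs_real_inner_le_norm _ _) (abs_nonneg _)
          _ ≤ |ν| * (‖v x‖ * (B₂ / R ^ 2)) := by gcongr
          _ = |ν| * (B₂ / R ^ 2) * ‖v x‖ := by ring
      · have hΔ0 : Δ ψ x = 0 :=
          laplacian_eq_zero_of_notMem_tsupport fun h =>
            hx (tsupport_curl_cutoff_smul_rotGen_subset' hR0 h)
        rw [hΔ0, inner_zero_right, abs_zero, mul_zero, indicator_of_notMem hx, mul_zero, mul_zero]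
    have h3 : ‖v x‖ * S.indicator (fun _ => (1 : ℝ)) x ≤
        (lam * S.indicator (fun _ => (1 : ℝ)) x + lam⁻¹ * ‖v x‖ ^ 2) / 2 := by
      by_cases hx : x ∈ S
      · rw [indicator_of_mem hx, mul_one, mul_one, le_div_iff₀ two_pos]
        have key : ‖v x‖ * 2 * lam ≤ (lam + lam⁻¹ * ‖v x‖ ^ 2) * lam := by
          have e : (lam + lam⁻¹ * ‖v x‖ ^ 2) * lam = lam ^ 2 + ‖v x‖ ^ 2 := by
            rw [add_mul, ← pow_two, mul_comm (lam⁻¹ * _) lam, ← mul_assoc, mul_inv_cancel₀ hlam0.ne',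
              one_mul]
          rw [e]
          nlinarith [sq_nonneg (lam - ‖v x‖)]
        exact le_of_mul_le_mul_right key hlam0
      · rw [indicator_of_notMem hx, mul_zero, mul_zero, zero_add]
        positivity
    calc ‖⟪v x, convect v ψ x⟫ + ν * ⟪v x, Δ ψ x⟫‖
        = |⟪v x, convect v ψ x⟫ + ν * ⟪v x, Δ ψ x⟫| := Real.norm_eq_abs _
      _ ≤ |⟪v x, convect v ψ x⟫| + |ν * ⟪v x, Δ ψ x⟫| := abs_add_le _ _
      _ ≤ B₁ / R * ‖v x‖ ^ 2 + |ν| * (B₂ / R ^ 2) * (‖v x‖ * S.indicator (fun _ => (1 : ℝ)) x) :=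
          add_le_add h1 h2
      _ ≤ g x := by
          simp only [hg]
          exact add_le_add le_rfl (mul_le_mul_of_nonneg_left h3 hνB)
  have hind : Integrable (S.indicator fun _ => (1 : ℝ)) :=
    (integrable_indicator_iff measurableSet_closedBall).2
      (integrableOn_const measure_closedBall_lt_top.ne)
  have i1 : Integrable (fun x => B₁ / R * ‖v x‖ ^ 2) := hv2.const_mul _
  have i2 : Integrable (fun x => lam * S.indicator (fun _ => (1 : ℝ)) x) := hind.const_mul _
  have i3 : Integrable (fun x => lam⁻¹ * ‖v x‖ ^ 2) := hv2.const_mul _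
  have i4 : Integrable (fun x =>
      (lam * S.indicator (fun _ => (1 : ℝ)) x + lam⁻¹ * ‖v x‖ ^ 2) / 2) := (i2.add i3).div_const 2
  have i5 : Integrable (fun x =>
      |ν| * (B₂ / R ^ 2) * ((lam * S.indicator (fun _ => (1 : ℝ)) x + lam⁻¹ * ‖v x‖ ^ 2) / 2)) :=
    i4.const_mul _
  have hgi : Integrable g := by
    rw [hg]
    exact i1.add i5
  have hvol : volume.real (closedBall (0 : EuclideanSpace ℝ (Fin 3)) (2 * R)) = (2 * R) ^ 3 * c₁ := by
    rw [measureReal_def, Measure.addHaar_closedBall _ _ (by positivity), ENNReal.toReal_mul,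
      finrank_euclideanSpace_fin, ENNReal.toReal_ofReal (by positivity)]
  have hIg : ∫ x, g x =
      B₁ / R * (∫ x, ‖v x‖ ^ 2) +
        |ν| * (B₂ / R ^ 2) * ((lam * ((2 * R) ^ 3 * c₁) + lam⁻¹ * ∫ x, ‖v x‖ ^ 2) / 2) := by
    simp only [hg]
    rw [integral_add i1 i5, integral_const_mul, integral_const_mul, integral_div,
      integral_add i2 i3, integral_const_mul, integral_const_mul,
      integral_indicator_const _ measurableSet_closedBall, hvol, smul_eq_mul, mul_one]
  calc |∫ x, (⟪v x, convect v ψ x⟫ + ν * ⟪v x, Δ ψ x⟫)|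
      = ‖∫ x, (⟪v x, convect v ψ x⟫ + ν * ⟪v x, Δ ψ x⟫)‖ := (Real.norm_eq_abs _).symm
    _ ≤ ∫ x, g x := norm_integral_le_of_norm_le hgi (Eventually.of_forall hbound)
    _ = B₁ / R * (∫ x, ‖v x‖ ^ 2) +
        |ν| * (B₂ / R ^ 2) * ((lam * ((2 * R) ^ 3 * c₁) + lam⁻¹ * ∫ x, ‖v x‖ ^ 2) / 2) := hIg
    _ ≤ B₁ / R * E + |ν| * (B₂ / R ^ 2) * ((lam * ((2 * R) ^ 3 * c₁) + lam⁻¹ * E) / 2) := by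
        gcongr
    _ = B₁ * E / (s * s) + |ν| * B₂ * (8 * c₁ + E) / 2 / s := by
        rw [hlam, ← hss]
        field_simp
        ring
    _ ≤ B₁ * E / s + |ν| * B₂ * (8 * c₁ + E) / 2 / s := by
        gcongr ?_ + _
        exact div_le_div_of_nonneg_left (by positivity) hs0
          (le_mul_of_one_le_left hs0.le hs1)
    _ = (B₁ * E + |ν| * B₂ * (8 * c₁ + E) / 2) / s := by ring

end SliceBound

/-! ### §4 Along a finite-energy classical forced solution: the pairing integrand and its limit -/

section Dynamics

variable {T ν : ℝ} {f u : ℝ → EuclideanSpace ℝ (Fin 3) → EuclideanSpace ℝ (Fin 3)}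
  {p : ℝ → EuclideanSpace ℝ (Fin 3) → ℝ}

/-- The axial impulse density `swirl (curl v)` of a `C¹` field is continuous. [folklore] -/
private theorem continuous_swirl_curl' {v : EuclideanSpace ℝ (Fin 3) → EuclideanSpace ℝ (Fin 3)}
    (hv : ContDiff ℝ 1 v) : Continuous fun x => swirl (curl v) x := by
  have hc : Continuous (curl v) := continuous_curl hv
  unfold swirl
  fun_prop

/-- A slice of a field continuous on `[0, T] × ℝ³` is continuous. [folklore] -/
private theorem continuous_slice_of_continuousOn {w : ℝ → EuclideanSpace ℝ (Fin 3) → EuclideanSpace ℝ (Fin 3)}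
    (hw : ContinuousOn (uncurry w) (Icc 0 T ×ˢ univ)) {τ : ℝ} (hτ : τ ∈ Icc 0 T) : Continuous (w τ) := by
  have h1 : ContinuousOn (fun x : EuclideanSpace ℝ (Fin 3) => uncurry w (τ, x)) univ :=
    hw.comp (continuous_const.prodMk continuous_id).continuousOn fun x _ => mk_mem_prod hτ (mem_univ x)
  exact continuousOn_univ.1 h1

/-- Off the ball of radius `2R` the test field, its Jacobian and its Laplacian vanish. [folklore] -/
private theorem testField_eq_zero_of_lt {R : ℝ} (hR : 0 < R) {x : EuclideanSpace ℝ (Fin 3)} (hx : 2 * R < ‖x‖) :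
    curl (fun y : EuclideanSpace ℝ (Fin 3) => cutoff R y • rotGen y) x = 0 ∧
    fderiv ℝ (curl fun y : EuclideanSpace ℝ (Fin 3) => cutoff R y • rotGen y) x = 0 ∧
    Δ (curl fun y : EuclideanSpace ℝ (Fin 3) => cutoff R y • rotGen y) x = 0 := by
  have hx' : x ∉ tsupport (curl fun y : EuclideanSpace ℝ (Fin 3) => cutoff R y • rotGen y) := fun h => by
    have := tsupport_curl_cutoff_smul_rotGen_subset' hR h
    rw [mem_closedBall, dist_zero_right] at this
    linarith
  exact ⟨image_eq_zero_of_notMem_tsupport hx', fderiv_of_notMem_tsupport ℝ hx',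
    laplacian_eq_zero_of_notMem_tsupport hx'⟩

/-- **The force pairing against the test fields tends to twice the axial mean**: for a continuous integrable
slice `g`, `∫ ⟪g, curl (χ_{n+1} J)⟫ dx → 2 ∫ g₃ dx` (the test fields are bounded by `B₀` and eventually equal to
`2e₃` at every point; dominated convergence). [folklore] -/
private theorem tendsto_integral_inner_testField {g : EuclideanSpace ℝ (Fin 3) → EuclideanSpace ℝ (Fin 3)}
    (hg : Continuous g) (hgi : Integrable g) :
    Tendsto (fun n : ℕ => ∫ x, ⟪g x, curl (fun y : EuclideanSpace ℝ (Fin 3) => cutoff ((n : ℝ) + 1) y • rotGen y) x⟫)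
      atTop (𝓝 (2 * ∫ x, g x 2)) := by
  obtain ⟨B₀, B₁, B₂, hB₀, -, -, hB⟩ := exists_bounds_curl_cutoff_smul_rotGen'
  have hlim : ∫ x, ⟪g x, (EuclideanSpace.single 2 (2 : ℝ) : EuclideanSpace ℝ (Fin 3))⟫ = 2 * ∫ x, g x 2 := by
    rw [← integral_const_mul]
    refine integral_congr_ae (Eventually.of_forall fun x => ?_)
    simp [EuclideanSpace.inner_single_right]
  rw [← hlim]
  refine tendsto_integral_filter_of_dominated_convergence (fun x => B₀ * ‖g x‖) ?_ ?_ (hgi.norm.const_mul B₀) ?_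
  · exact Eventually.of_forall fun n =>
      (hg.inner (contDiff_curl_cutoff_smul_rotGen' 0 _).continuous).aestronglyMeasurable
  · refine Eventually.of_forall fun n => Eventually.of_forall fun x => ?_
    have hn0 : (0 : ℝ) < (n : ℝ) + 1 := by positivity
    calc ‖⟪g x, curl (fun y : EuclideanSpace ℝ (Fin 3) => cutoff ((n : ℝ) + 1) y • rotGen y) x⟫‖
        ≤ ‖g x‖ * ‖curl (fun y : EuclideanSpace ℝ (Fin 3) => cutoff ((n : ℝ) + 1) y • rotGen y) x‖ :=
          norm_inner_le_norm _ _
      _ ≤ ‖g x‖ * B₀ := by gcongr; exact (hB _ hn0 x).1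
      _ = B₀ * ‖g x‖ := mul_comm _ _
  · exact Eventually.of_forall fun x => tendsto_const_nhds.inner (tendsto_curl_cutoff_smul_rotGen x)

/-- **The pairing integrand and its behaviour** along a finite-energy classical forced solution on `[0, T]`
(`0 < T`, uniform energy level `∫ ‖u(τ)‖² ≤ E`, integrable majorant `F` of the force slices): with
`ψ_n = curl (χ_{n+1} J)` and the integrand
`Θ_n(τ) = ∫ (⟪u,(u·∇)ψ_n⟫ + ν⟪u,Δψ_n⟫ + ⟪f,ψ_n⟫) + ∫ p div ψ_n` of
`IsClassicalNSSolutionOn.integral_inner_sub_eq_pressure`, for every `τ ∈ [0, T]`: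
`|Θ_n(τ)| ≤ M` uniformly in `n` and `Θ_n(τ) → 2 ∫ f₃(τ, x) dx` (the transport and viscous pairings are
`O(1/√n)` by the slice estimate; the pressure pairs with `div ψ_n = 0`). [cite: Leray1934, §III (17)] -/
private theorem IsClassicalNSSolutionOn.pairing_integrand_bound_and_tendsto
    (h : IsClassicalNSSolutionOn (Icc 0 T) ν f u p) (hT : 0 < T) {E : ℝ}
    (h2 : ∀ τ ∈ Icc 0 T, Integrable fun x => ‖u τ x‖ ^ 2) (hE : ∀ τ ∈ Icc 0 T, ∫ x, ‖u τ x‖ ^ 2 ≤ E)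
    {F : EuclideanSpace ℝ (Fin 3) → ℝ} (hF : Integrable F) (hfF : ∀ τ ∈ Icc 0 T, ∀ x, ‖f τ x‖ ≤ F x) :
    ∃ M : ℝ, ∀ τ ∈ Icc 0 T,
      (∀ n : ℕ, |(∫ x, (⟪u τ x, convect (u τ)
            (curl fun y : EuclideanSpace ℝ (Fin 3) => cutoff ((n : ℝ) + 1) y • rotGen y) x⟫ +
          ν * ⟪u τ x, Δ (curl fun y : EuclideanSpace ℝ (Fin 3) => cutoff ((n : ℝ) + 1) y • rotGen y) x⟫ +
          ⟪f τ x, curl (fun y : EuclideanSpace ℝ (Fin 3) => cutoff ((n : ℝ) + 1) y • rotGen y) x⟫)) +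
        ∫ x, p τ x * VectorCalculus.divergence
          (curl fun y : EuclideanSpace ℝ (Fin 3) => cutoff ((n : ℝ) + 1) y • rotGen y) x| ≤ M) ∧
      Tendsto (fun n : ℕ => (∫ x, (⟪u τ x, convect (u τ)
            (curl fun y : EuclideanSpace ℝ (Fin 3) => cutoff ((n : ℝ) + 1) y • rotGen y) x⟫ +
          ν * ⟪u τ x, Δ (curl fun y : EuclideanSpace ℝ (Fin 3) => cutoff ((n : ℝ) + 1) y • rotGen y) x⟫ +
          ⟪f τ x, curl (fun y : EuclideanSpace ℝ (Fin 3) => cutoff ((n : ℝ) + 1) y • rotGen y) x⟫)) +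
        ∫ x, p τ x * VectorCalculus.divergence
          (curl fun y : EuclideanSpace ℝ (Fin 3) => cutoff ((n : ℝ) + 1) y • rotGen y) x)
        atTop (𝓝 (2 * ∫ x, f τ x 2)) := by
  obtain ⟨K, hK⟩ := exists_pairing_bound' ν E
  obtain ⟨B₀, B₁, B₂, hB₀, -, -, hB⟩ := exists_bounds_curl_cutoff_smul_rotGen'
  have hfc : ContinuousOn (uncurry f) (Icc 0 T ×ˢ univ) :=
    (h.isSmoothSpaceTimeOn_force (uniqueDiffOn_Icc hT)).continuousOn
  refine ⟨max K 0 + B₀ * ∫ x, F x, fun τ hτ => ?_⟩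
  -- notation for the slices at time `τ`
  have hu1 : Continuous (u τ) := (h.contDiff_velocity hτ).continuous
  have hf1 : Continuous (f τ) := continuous_slice_of_continuousOn hfc hτ
  have hfi : Integrable (f τ) := hF.mono' hf1.aestronglyMeasurable (Eventually.of_forall (hfF τ hτ))
  set ψ : ℕ → EuclideanSpace ℝ (Fin 3) → EuclideanSpace ℝ (Fin 3) := fun n =>
    curl fun y : EuclideanSpace ℝ (Fin 3) => cutoff ((n : ℝ) + 1) y • rotGen y with hψ
  have hn0 : ∀ n : ℕ, (0 : ℝ) < (n : ℝ) + 1 := fun n => by positivity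
  have hn1 : ∀ n : ℕ, (1 : ℝ) ≤ (n : ℝ) + 1 := fun n => le_add_of_nonneg_left (Nat.cast_nonneg n)
  have hψ2 : ∀ n, ContDiff ℝ 2 (ψ n) := fun n => contDiff_curl_cutoff_smul_rotGen' 2 _
  -- the pressure term vanishes
  have hdiv : ∀ n, (fun x => p τ x * VectorCalculus.divergence (ψ n) x) = fun _ => 0 := fun n => by
    funext x
    simp only [hψ, divergence_curl_cutoff_smul_rotGen', mul_zero]
  -- integrability of the two pieces (compact support of `ψ n`)
  have hK2 : ∀ n : ℕ, IsCompact (closedBall (0 : EuclideanSpace ℝ (Fin 3)) (2 * ((n : ℝ) + 1))) :=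
    fun n => isCompact_closedBall _ _
  have hout : ∀ n : ℕ, ∀ x ∉ closedBall (0 : EuclideanSpace ℝ (Fin 3)) (2 * ((n : ℝ) + 1)),
      ψ n x = 0 ∧ fderiv ℝ (ψ n) x = 0 ∧ Δ (ψ n) x = 0 := fun n x hx => by
    rw [mem_closedBall, dist_zero_right, not_le] at hx
    exact testField_eq_zero_of_lt (hn0 n) hx
  have iA : ∀ n, Integrable fun x => ⟪u τ x, convect (u τ) (ψ n) x⟫ + ν * ⟪u τ x, Δ (ψ n) x⟫ := by
    intro n
    refine Continuous.integrable_of_hasCompactSupport ?_ (HasCompactSupport.intro (hK2 n) fun x hx => ?_)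
    · exact (hu1.inner ((((hψ2 n).continuous_fderiv (by simp)).clm_apply hu1).congr fun x => rfl)).add
        (continuous_const.mul (hu1.inner (continuous_laplacian (hψ2 n))))
    · obtain ⟨-, h1, h2⟩ := hout n x hx
      simp [convect, h1, h2]
  have iF : ∀ n, Integrable fun x => ⟪f τ x, ψ n x⟫ := fun n =>
    integrable_inner_of_hasCompactSupport_right hf1 (hψ2 n).continuous
      (hasCompactSupport_curl_cutoff_smul_rotGen' (hn0 n))
  -- the integrand splits
  have hsplit : ∀ n, (∫ x, (⟪u τ x, convect (u τ) (ψ n) x⟫ + ν * ⟪u τ x, Δ (ψ n) x⟫ + ⟪f τ x, ψ n x⟫)) +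
      ∫ x, p τ x * VectorCalculus.divergence (ψ n) x =
      (∫ x, (⟪u τ x, convect (u τ) (ψ n) x⟫ + ν * ⟪u τ x, Δ (ψ n) x⟫)) + ∫ x, ⟪f τ x, ψ n x⟫ := by
    intro n
    rw [hdiv n, integral_zero, add_zero, integral_add (iA n) (iF n)]
  -- bounds on the pieces
  have hA : ∀ n, |∫ x, (⟪u τ x, convect (u τ) (ψ n) x⟫ + ν * ⟪u τ x, Δ (ψ n) x⟫)| ≤
      K / Real.sqrt ((n : ℝ) + 1) := fun n => hK _ (hn1 n) (u τ) hu1 (h2 τ hτ) (hE τ hτ)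
  have hΦ : ∀ n, |∫ x, ⟪f τ x, ψ n x⟫| ≤ B₀ * ∫ x, F x := by
    intro n
    rw [← Real.norm_eq_abs, ← integral_const_mul]
    refine norm_integral_le_of_norm_le (hF.const_mul B₀) (Eventually.of_forall fun x => ?_)
    calc ‖⟪f τ x, ψ n x⟫‖ ≤ ‖f τ x‖ * ‖ψ n x‖ := norm_inner_le_norm _ _
      _ ≤ F x * B₀ := by
          gcongr
          · exact (norm_nonneg _).trans (hfF τ hτ x)
          · exact hfF τ hτ x
          · exact (hB _ (hn0 n) x).1
      _ = B₀ * F x := mul_comm _ _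
  refine ⟨fun n => ?_, ?_⟩
  · rw [hsplit n]
    have hKn : K / Real.sqrt ((n : ℝ) + 1) ≤ max K 0 := by
      rcases le_or_gt K 0 with hK0 | hK0
      · exact (div_nonpos_of_nonpos_of_nonneg hK0 (Real.sqrt_nonneg _)).trans (le_max_right _ _)
      · exact (div_le_self hK0.le (Real.one_le_sqrt.2 (hn1 n))).trans (le_max_left _ _)
    calc |(∫ x, (⟪u τ x, convect (u τ) (ψ n) x⟫ + ν * ⟪u τ x, Δ (ψ n) x⟫)) + ∫ x, ⟪f τ x, ψ n x⟫|
        ≤ |∫ x, (⟪u τ x, convect (u τ) (ψ n) x⟫ + ν * ⟪u τ x, Δ (ψ n) x⟫)| + |∫ x, ⟪f τ x, ψ n x⟫| :=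
          abs_add_le _ _
      _ ≤ max K 0 + B₀ * ∫ x, F x := add_le_add ((hA n).trans hKn) (hΦ n)
  · have hA0 : Tendsto (fun n : ℕ => ∫ x, (⟪u τ x, convect (u τ) (ψ n) x⟫ + ν * ⟪u τ x, Δ (ψ n) x⟫))
        atTop (𝓝 0) := by
      have hrate : Tendsto (fun n : ℕ => K / Real.sqrt ((n : ℝ) + 1)) atTop (𝓝 0) := by
        have h1 : Tendsto (fun n : ℕ => Real.sqrt ((n : ℝ) + 1)) atTop atTop :=
          Real.tendsto_sqrt_atTop.comp (tendsto_natCast_atTop_atTop.atTop_add tendsto_const_nhds)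
        exact tendsto_const_nhds.div_atTop h1
      refine squeeze_zero_norm (fun n => ?_) hrate
      rw [Real.norm_eq_abs]
      exact hA n
    have hΦlim := tendsto_integral_inner_testField hf1 hfi
    have := hA0.add hΦlim
    rw [zero_add] at this
    exact this.congr fun n => (hsplit n).symm

/-- **The pairing integrand is continuous in time** (each of its two integrals is `∫ χ_{4R}(x) G(τ, x) dx` with
`G` continuous on the slab; Mathlib `continuousOn_integral_of_compact_support`). [folklore] -/
private theorem IsClassicalNSSolutionOn.continuousOn_pairing_integrand
    (h : IsClassicalNSSolutionOn (Icc 0 T) ν f u p) (hT : 0 < T) {R : ℝ} (hR : 0 < R) :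
    ContinuousOn (fun τ => (∫ x, (⟪u τ x, convect (u τ)
            (curl fun y : EuclideanSpace ℝ (Fin 3) => cutoff R y • rotGen y) x⟫ +
          ν * ⟪u τ x, Δ (curl fun y : EuclideanSpace ℝ (Fin 3) => cutoff R y • rotGen y) x⟫ +
          ⟪f τ x, curl (fun y : EuclideanSpace ℝ (Fin 3) => cutoff R y • rotGen y) x⟫)) +
        ∫ x, p τ x * VectorCalculus.divergence
          (curl fun y : EuclideanSpace ℝ (Fin 3) => cutoff R y • rotGen y) x) (Icc 0 T) := by
  set ψ : EuclideanSpace ℝ (Fin 3) → EuclideanSpace ℝ (Fin 3) :=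
    curl fun y : EuclideanSpace ℝ (Fin 3) => cutoff R y • rotGen y with hψ
  have hψ2 : ContDiff ℝ 2 ψ := contDiff_curl_cutoff_smul_rotGen' 2 _
  have hU := uniqueDiffOn_Icc hT
  have huc : ContinuousOn (uncurry u) (Icc 0 T ×ˢ univ) := h.smooth_velocity.continuousOn
  have hfc : ContinuousOn (uncurry f) (Icc 0 T ×ˢ univ) := (h.isSmoothSpaceTimeOn_force hU).continuousOn
  have hpc : ContinuousOn (uncurry p) (Icc 0 T ×ˢ univ) := h.smooth_pressure.continuousOn
  -- the cut-off `χ_{2R}` is `1` on the support of `ψ`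
  set φ : EuclideanSpace ℝ (Fin 3) → ℝ := cutoff (2 * R) with hφ
  have hφc : Continuous φ := (contDiff_cutoff (n := 0) _).continuous
  have hφs : HasCompactSupport φ := hasCompactSupport_cutoff (by positivity)
  have hφψ : ∀ x, ∀ v : ℝ, (‖x‖ ≤ 2 * R → True) →
      (2 * R < ‖x‖ → v = 0) → φ x * v = v := by
    intro x v _ h0
    by_cases hx : ‖x‖ ≤ 2 * R
    · rw [hφ, cutoff_eq_one (by positivity) hx, one_mul]
    · rw [not_le] at hx
      rw [h0 hx, mul_zero]
  -- the two scalar integrands as functions on the slab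
  set G₁ : ℝ × EuclideanSpace ℝ (Fin 3) → ℝ := fun z =>
    ⟪u z.1 z.2, convect (u z.1) ψ z.2⟫ + ν * ⟪u z.1 z.2, Δ ψ z.2⟫ + ⟪f z.1 z.2, ψ z.2⟫ with hG₁
  set G₂ : ℝ × EuclideanSpace ℝ (Fin 3) → ℝ := fun z => p z.1 z.2 * VectorCalculus.divergence ψ z.2 with hG₂
  have hψfc : Continuous fun x => fderiv ℝ ψ x := hψ2.continuous_fderiv (by simp)
  have hG₁c : ContinuousOn G₁ (Icc 0 T ×ˢ univ) := by
    have hψ' : ContinuousOn (fun z : ℝ × EuclideanSpace ℝ (Fin 3) => ψ z.2) (Icc 0 T ×ˢ univ) :=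
      (hψ2.continuous.comp continuous_snd).continuousOn
    have hDψ : ContinuousOn (fun z : ℝ × EuclideanSpace ℝ (Fin 3) => fderiv ℝ ψ z.2) (Icc 0 T ×ˢ univ) :=
      (hψfc.comp continuous_snd).continuousOn
    have hΔψ : ContinuousOn (fun z : ℝ × EuclideanSpace ℝ (Fin 3) => Δ ψ z.2) (Icc 0 T ×ˢ univ) :=
      ((continuous_laplacian hψ2).comp continuous_snd).continuousOn
    exact ((huc.inner (hDψ.clm_apply huc)).add (continuousOn_const.mul (huc.inner hΔψ))).add
      (hfc.inner hψ')
  have hG₂c : ContinuousOn G₂ (Icc 0 T ×ˢ univ) :=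
    hpc.mul ((continuous_divergence hψfc).comp continuous_snd).continuousOn
  have e₁ : ∀ τ, (∫ x, (⟪u τ x, convect (u τ) ψ x⟫ + ν * ⟪u τ x, Δ ψ x⟫ + ⟪f τ x, ψ x⟫)) =
      ∫ x, φ x * G₁ (τ, x) := by
    intro τ
    refine integral_congr_ae (Eventually.of_forall fun x => ?_)
    refine (hφψ x _ (fun _ => trivial) fun hx => ?_).symm
    obtain ⟨h0, h1, h2⟩ := testField_eq_zero_of_lt hR hx
    simp [hψ, convect, h0, h1, h2]
  have e₂ : ∀ τ, (∫ x, p τ x * VectorCalculus.divergence ψ x) = ∫ x, φ x * G₂ (τ, x) := by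
    intro τ
    refine integral_congr_ae (Eventually.of_forall fun x => ?_)
    simp only [hG₂, hψ, divergence_curl_cutoff_smul_rotGen', mul_zero]
  have hc₁ := continuousOn_integral_mul_of_continuousOn hφc hφs hG₁c
  have hc₂ := continuousOn_integral_mul_of_continuousOn hφc hφs hG₂c
  refine ((hc₁.add hc₂).congr fun τ _ => ?_)
  simp only [Pi.add_apply, e₁ τ, e₂ τ]

/-! ### §5 The axial impulse balance from the energy -/

/-- **TRUNCATED AXIAL IMPULSE BALANCE (Saffman (3.2.9) from the energy alone).** Let `(u, p)` be a classical
solution of the Navier–Stokes system (any viscosity `ν`) with force `f` on `[0, T] × ℝ³`, `0 < T`, with a uniform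
energy level `∫ ‖u(τ)‖² ≤ E` and an integrable majorant of the force slices. Then for `0 ≤ s ≤ t ≤ T` the
truncated axial impulses satisfy
`∫ χ_n (x × ω)₃(t) dx − ∫ χ_n (x × ω)₃(s) dx → 2 ∫ₛᵗ ∫ f₃ dx dτ` as `n → ∞` (`χ_n = cutoff (n+1)`,
`(x × ω)₃ = swirl ω`). NO decay of the vorticity is assumed. [cite: Saffman1992, §3.2 eq. (3.2.9)] -/
theorem IsClassicalNSSolutionOn.tendsto_integral_cutoff_swirl_vorticity_sub
    (h : IsClassicalNSSolutionOn (Icc 0 T) ν f u p) (hT : 0 < T) {E : ℝ}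
    (h2 : ∀ τ ∈ Icc 0 T, Integrable fun x => ‖u τ x‖ ^ 2) (hE : ∀ τ ∈ Icc 0 T, ∫ x, ‖u τ x‖ ^ 2 ≤ E)
    {F : EuclideanSpace ℝ (Fin 3) → ℝ} (hF : Integrable F) (hfF : ∀ τ ∈ Icc 0 T, ∀ x, ‖f τ x‖ ≤ F x)
    {s t : ℝ} (hs : 0 ≤ s) (hst : s ≤ t) (ht : t ≤ T) :
    Tendsto (fun n : ℕ => (∫ x, cutoff ((n : ℝ) + 1) x * swirl (curl (u t)) x) -
        ∫ x, cutoff ((n : ℝ) + 1) x * swirl (curl (u s)) x) atTop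
      (𝓝 (2 * ∫ τ in s..t, ∫ x, f τ x 2)) := by
  obtain ⟨M, hM⟩ := h.pairing_integrand_bound_and_tendsto hT h2 hE hF hfF
  have htT : t ∈ Icc 0 T := ⟨hs.trans hst, ht⟩
  have hsT : s ∈ Icc 0 T := ⟨hs, hst.trans ht⟩
  have hIcc : ∀ τ ∈ Ι s t, τ ∈ Icc 0 T := fun τ hτ => by
    rw [uIoc_of_le hst] at hτ
    exact ⟨hs.trans hτ.1.le, hτ.2.trans ht⟩
  have hn0 : ∀ n : ℕ, (0 : ℝ) < (n : ℝ) + 1 := fun n => by positivity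
  -- the truncated impulses are velocity pairings, and the pairing identity
  have hpair : ∀ n : ℕ, (∫ x, cutoff ((n : ℝ) + 1) x * swirl (curl (u t)) x) -
      (∫ x, cutoff ((n : ℝ) + 1) x * swirl (curl (u s)) x) =
      ∫ τ in s..t, ((∫ x, (⟪u τ x, convect (u τ)
            (curl fun y : EuclideanSpace ℝ (Fin 3) => cutoff ((n : ℝ) + 1) y • rotGen y) x⟫ +
          ν * ⟪u τ x, Δ (curl fun y : EuclideanSpace ℝ (Fin 3) => cutoff ((n : ℝ) + 1) y • rotGen y) x⟫ +
          ⟪f τ x, curl (fun y : EuclideanSpace ℝ (Fin 3) => cutoff ((n : ℝ) + 1) y • rotGen y) x⟫)) +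
        ∫ x, p τ x * VectorCalculus.divergence
          (curl fun y : EuclideanSpace ℝ (Fin 3) => cutoff ((n : ℝ) + 1) y • rotGen y) x) := by
    intro n
    rw [integral_cutoff_mul_swirl_curl_eq_inner ((h.contDiff_velocity htT).of_le (by norm_cast)) (hn0 n),
      integral_cutoff_mul_swirl_curl_eq_inner ((h.contDiff_velocity hsT).of_le (by norm_cast)) (hn0 n),
      h.integral_inner_sub_eq_pressure hT (contDiff_curl_cutoff_smul_rotGen' 2 _)
        (hasCompactSupport_curl_cutoff_smul_rotGen' (hn0 n)) hs hst ht]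
  simp_rw [hpair]
  rw [← intervalIntegral.integral_const_mul]
  refine intervalIntegral.tendsto_integral_filter_of_dominated_convergence (fun _ => M) ?_ ?_ ?_ ?_
  · refine Eventually.of_forall fun n => ?_
    refine ContinuousOn.aestronglyMeasurable ?_ measurableSet_uIoc
    refine (h.continuousOn_pairing_integrand hT (hn0 n)).mono fun τ hτ => hIcc τ hτ
  · exact Eventually.of_forall fun n => Eventually.of_forall fun τ hτ => by
      rw [Real.norm_eq_abs]; exact (hM τ (hIcc τ hτ)).1 n
  · exact intervalIntegrable_const
  · exact Eventually.of_forall fun τ hτ => (hM τ (hIcc τ hτ)).2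

/-- **THE AXIAL IMPULSE BALANCE FROM THE ENERGY (Saffman (3.2.9)).** Under the hypotheses of
`tendsto_integral_cutoff_swirl_vorticity_sub` (classical forced solution on `[0, T]`, uniform energy level,
integrable force majorant — NO vorticity decay), if the axial impulse densities `(x × ω)₃ = swirl ω` at the two
times `s ≤ t` are integrable then
`∫ swirl ω(t) dx − ∫ swirl ω(s) dx = 2 ∫ₛᵗ ∫ f₃ dx dτ`:
the axial impulse `I₃ = ½∫(x × ω)₃` changes exactly by the total axial push. [cite: Saffman1992, §3.2 eq. (3.2.9)] -/
theorem IsClassicalNSSolutionOn.integral_swirl_vorticity_sub_eq_of_energy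
    (h : IsClassicalNSSolutionOn (Icc 0 T) ν f u p) (hT : 0 < T) {E : ℝ}
    (h2 : ∀ τ ∈ Icc 0 T, Integrable fun x => ‖u τ x‖ ^ 2) (hE : ∀ τ ∈ Icc 0 T, ∫ x, ‖u τ x‖ ^ 2 ≤ E)
    {F : EuclideanSpace ℝ (Fin 3) → ℝ} (hF : Integrable F) (hfF : ∀ τ ∈ Icc 0 T, ∀ x, ‖f τ x‖ ≤ F x)
    {s t : ℝ} (hs : 0 ≤ s) (hst : s ≤ t) (ht : t ≤ T)
    (hIs : Integrable fun x => swirl (curl (u s)) x) (hIt : Integrable fun x => swirl (curl (u t)) x) :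
    (∫ x, swirl (curl (u t)) x) - ∫ x, swirl (curl (u s)) x = 2 * ∫ τ in s..t, ∫ x, f τ x 2 :=
  tendsto_nhds_unique ((tendsto_integral_cutoff_mul hIt).sub (tendsto_integral_cutoff_mul hIs))
    (h.tendsto_integral_cutoff_swirl_vorticity_sub hT h2 hE hF hfF hs hst ht)

/-- **FATOU FORM: a single-signed axial impulse density at the later time is automatically integrable.** Under
the same hypotheses, if `swirl ω(s) ∈ L¹` and `swirl ω(t) ≥ 0` pointwise (a single-signed slice — a vortex ring,
Hill's vortex), then `swirl ω(t) ∈ L¹` and `∫ swirl ω(t) = ∫ swirl ω(s) + 2 ∫ₛᵗ ∫ f₃`.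
[cite: Saffman1992, §3.2 eq. (3.2.9)] [cite: GallaySverak2016, Lemma 6.4 (arXiv p. 19)] -/
theorem IsClassicalNSSolutionOn.integrable_swirl_vorticity_of_nonneg
    (h : IsClassicalNSSolutionOn (Icc 0 T) ν f u p) (hT : 0 < T) {E : ℝ}
    (h2 : ∀ τ ∈ Icc 0 T, Integrable fun x => ‖u τ x‖ ^ 2) (hE : ∀ τ ∈ Icc 0 T, ∫ x, ‖u τ x‖ ^ 2 ≤ E)
    {F : EuclideanSpace ℝ (Fin 3) → ℝ} (hF : Integrable F) (hfF : ∀ τ ∈ Icc 0 T, ∀ x, ‖f τ x‖ ≤ F x)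
    {s t : ℝ} (hs : 0 ≤ s) (hst : s ≤ t) (ht : t ≤ T)
    (hIs : Integrable fun x => swirl (curl (u s)) x) (hnn : ∀ x, 0 ≤ swirl (curl (u t)) x) :
    Integrable (fun x => swirl (curl (u t)) x) ∧
      (∫ x, swirl (curl (u t)) x) = (∫ x, swirl (curl (u s)) x) + 2 * ∫ τ in s..t, ∫ x, f τ x 2 := by
  have htT : t ∈ Icc 0 T := ⟨hs.trans hst, ht⟩
  set G : EuclideanSpace ℝ (Fin 3) → ℝ := fun x => swirl (curl (u t)) x with hG
  have hGc : Continuous G :=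
    continuous_swirl_curl' ((h.contDiff_velocity htT).of_le (by norm_cast))
  set I : ℝ := (∫ x, swirl (curl (u s)) x) + 2 * ∫ τ in s..t, ∫ x, f τ x 2 with hI
  -- the truncated impulses at time `t` converge to `I`
  have hlimt : Tendsto (fun n : ℕ => ∫ x, cutoff ((n : ℝ) + 1) x * G x) atTop (𝓝 I) := by
    have h1 := (h.tendsto_integral_cutoff_swirl_vorticity_sub hT h2 hE hF hfF hs hst ht).add
      (tendsto_integral_cutoff_mul hIs)
    rw [hI, add_comm]
    exact h1.congr fun n => sub_add_cancel _ _
  -- Fatou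
  have hint : ∀ n : ℕ, Integrable fun x => cutoff ((n : ℝ) + 1) x * G x := fun n =>
    ((contDiff_cutoff (n := 0) _).continuous.mul hGc).integrable_of_hasCompactSupport
      ((hasCompactSupport_cutoff (by positivity)).mul_right)
  have hFatou : ∫⁻ x, ENNReal.ofReal (G x) ≤ ENNReal.ofReal I := by
    have hmeas : ∀ n : ℕ, Measurable fun x => ENNReal.ofReal (cutoff ((n : ℝ) + 1) x * G x) :=
      fun n => ENNReal.measurable_ofReal.comp (((contDiff_cutoff (n := 0) _).continuous.mul hGc).measurable)
    have hptw : ∀ x, Tendsto (fun n : ℕ => ENNReal.ofReal (cutoff ((n : ℝ) + 1) x * G x)) atTop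
        (𝓝 (ENNReal.ofReal (G x))) := fun x =>
      ENNReal.tendsto_ofReal (by simpa using (tendsto_cutoff_natCast_add_one x).mul_const (G x))
    have hnn' : ∀ n : ℕ, 0 ≤ᵐ[volume] fun x => cutoff ((n : ℝ) + 1) x * G x := fun n =>
      Eventually.of_forall fun x => mul_nonneg (cutoff_nonneg _ _) (hnn x)
    calc ∫⁻ x, ENNReal.ofReal (G x)
        = ∫⁻ x, liminf (fun n : ℕ => ENNReal.ofReal (cutoff ((n : ℝ) + 1) x * G x)) atTop :=
          lintegral_congr fun x => ((hptw x).liminf_eq).symm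
      _ ≤ liminf (fun n : ℕ => ∫⁻ x, ENNReal.ofReal (cutoff ((n : ℝ) + 1) x * G x)) atTop :=
          lintegral_liminf_le hmeas
      _ = liminf (fun n : ℕ => ENNReal.ofReal (∫ x, cutoff ((n : ℝ) + 1) x * G x)) atTop := by
          refine liminf_congr (Eventually.of_forall fun n => ?_)
          rw [ofReal_integral_eq_lintegral_ofReal (hint n) (hnn' n)]
      _ = ENNReal.ofReal I := (ENNReal.tendsto_ofReal hlimt).liminf_eq
  have hGint : Integrable G := by
    refine ⟨hGc.aestronglyMeasurable, ?_⟩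
    exact (hasFiniteIntegral_iff_ofReal (Eventually.of_forall hnn)).2
      (hFatou.trans_lt ENNReal.ofReal_lt_top)
  exact ⟨hGint, tendsto_nhds_unique (tendsto_integral_cutoff_mul hGint) hlimt⟩

end Dynamics

end Literature.Analysis.FluidPDE

end
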